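import Mathlib
import HarnessLib
import Summits.HubbardSuperconductivity.HubbardSuperconductivity.Theses.ComplexGFFStiffness
import Summits.HubbardSuperconductivity.HubbardSuperconductivity.Theorems.ComplexGFFStiffnessH1Sigma2Shrink
import Literature.MathematicalPhysics.StatisticalMechanics.AbkmPackageShrunkSlots

/-!
# Route `ComplexGFFStiffness`, child `H1bcStatement` of the crux `HypACumulant` — CLOSED (shrunk-ball form)

The route child `H1bcStatement` (item `stmt-HubbardSuperconductivity-27416`, re-typed 2026-08-31 by the
crux-strategist on the shrunk state ball) is by definition
`Literature.MathematicalPhysics.StatisticalMechanics.GradientRG.H1bcStatementShrink 4`: for every `d = 4` [ABKM19]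
package `P`, an `N`-FREE joint state second-difference size `σ₂ ≥ 0` of `(u, v) ↦ S_q(u, v)` (slot `H1σ2`) for the
shrunk package `P.shrink` (state corners in the `P.r/8`-ball, Theorem 6.8 on the `P.r`-ball), at every height.
It is the `d = 4` instance of `Theorems.ComplexGFF.h1bcStatement_shrink` (the holomorphic route S6c end-to-end:
`…HolomorphicStepFamily` → `…HolomorphicTorusFamily` → `…HolomorphicPackageLines` → `…H1Sigma2Shrink`).

Honest scope: this closes ONE re-typed child of ONE crux of a rung route (stiffness of a complex Gaussian gradient
field via the [ABKM19] renormalisation group); it does not prove the crux `HypACumulant`, the route, or anything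
about superconductivity in the Hubbard model.

## References
* S. Adams, S. Buchholz, R. Kotecký, S. Müller, arXiv:1910.13564, Theorem 6.8 (smoothness of `S`), Ch. 12 (12.4)
  [AdamsBuchholzKoteckyMuller2019].
-/

-- `Summit.<Summit>.<Problem>`: single-conjunct summit, the duplicate component is mandated (D-0017).
set_option linter.dupNamespace false

namespace Summit.HubbardSuperconductivity.HubbardSuperconductivity.Theorems

/-- **The route child `H1bcStatement` holds**: the `d = 4` instance of `ComplexGFF.h1bcStatement_shrink`
(an `N`-free `σ₂` for the slot `H1σ2` of every shrunk package). [cite: AdamsBuchholzKoteckyMuller2019, Thm 6.8 / Ch. 12 (12.4)] -/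
theorem H1bcStatement_proof :
    Summit.HubbardSuperconductivity.HubbardSuperconductivity.Theses.ComplexGFFStiffness.H1bcStatement := by
  unfold Summit.HubbardSuperconductivity.HubbardSuperconductivity.Theses.ComplexGFFStiffness.H1bcStatement
    Literature.MathematicalPhysics.StatisticalMechanics.GradientRG.H1bcStatementShrink
  intro P _ _
  exact ComplexGFF.h1bcStatement_shrink P

end Summit.HubbardSuperconductivity.HubbardSuperconductivity.Theorems
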